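import Summits.BirchSwinnertonDyer.Rank1Residual.Partition.Corners
import Summits.BirchSwinnertonDyer.Rank1Residual.Partition.CornersCM
import HarnessLib

/-!
# The strong partial theorem AT `p = 3`: the named corners of RESIDUAL-MAP.md §S (small primes)
# as one kernel statement, and the three flag-carrying COVERED cells at `3` in quotable form
# (cell `b2b-bsdres`, seat rmap-3; coordinator ruling 2026-08-20T22:24Z "axis blocks end in explicit
# corner predicates"; RESIDUAL-MAP.md §S.5 'what the headline theorem says at p = 3')

HONEST FRAMING (run/shared/lean/b2b/bsd-rank1-residual/, verbatim in every file): the goal of the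
cell is to DELETE the COMBINATION-SHAPED residual classes of the Birch–Swinnerton-Dyer formula for
ALL analytic-rank `≤ 1` elliptic curves over `ℚ` — "full BSD formula for every rank `≤ 1` curve in
class `C`" assembled STRICTLY from published theorems — so that the rank-`≤ 1` remainder becomes
exactly the CONSTRUCTION-SHAPED classes, which are TYPED (missing-input `Prop`s), NOT attempted.
This is not "finishing BSD". Nothing here is a Literature statement; NO named fact is introduced;
every theorem below is a SPECIALISATION at the prime `3` of rmap-1's `Partition/Corners.lean`
(`bsdp_of_not_corner'`, `bsdp_goodSS_rankOne_semistable`, `bsdp_mult_rankZero_of_irr_of_ram`),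
with the elementary facts that empty or decide corners at `3`: class X9 needs `5 ≤ p`
(`not_classX9_three` — NO appeal to Balakrishnan–Dogra–Müller–Tuitman–Vonk here, unlike the
`p ≥ 11` forms), a surjective `ρ̄_{E,3}` is irreducible, good ordinary excludes good supersingular,
good excludes multiplicative, and at an odd good supersingular prime `E[p]` is irreducible
(Serre 1972 §1.11, tree `hasIrreducibleModPGaloisRep_of_dvd_frobeniusTrace`). The PUB\* flags of the
covered rows at `3` travel with the named facts exactly as in `Partition/Bsdp.lean`: `hYZ`
(Yan–Zhu 2026 Thm 4.15 at `p = 3`, flag `YZ26@3-BF-ERL-Ohta`), `hJSW` (JSW 2017 Thm 1.2.1 at a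
supersingular `3` with `a_3 = 0`, flag `JSW-ss`), `hCGS` (Castella–Grossi–Skinner 2025 Thm D,
informational flag `CGS25-BST-Thm311`), `hKob` (Kobayashi 2013 Cor. 1.4, `KOB13-primary-unread`).

THE STATEMENT AT `p = 3` (RESIDUAL-MAP.md §S.5, rmap-3 gen 2/3). For EVERY globally minimal elliptic
`W/ℚ` (CM or not) of analytic rank `r ≤ 1` such that `3` is a GOOD prime, or `3` is MULTIPLICATIVE and
`r = 0`: `BSDp W 3` holds — granted the fourteen named published facts of the covered rows — UNLESS
`(W, 3)` lies in one of the SEVEN named corners at `3`: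
* `ClassX10 W 3 ∧ ¬ Surj W 3` (X10b: good ordinary, image `3Ns`/`3Nn` — NEEDS Mazur's MC at `3`),
* `ClassX1 W 3` (Eisenstein anomalous good `3` outside the `r = 0 ∧ GV-parity` quadrant),
* `ClassX6 W 3 ∧ r = 0` (supersingular `a_3 = 0`, semistable, rank `0` — Kobayashi's MC; BSTW PRE),
* `ClassX7 W 3` (supersingular `a_3 = 0`, `E` non-semistable),
* `ClassX8 W 3` (supersingular with `a_3 = ±3` — Sprung's ♯/♭ MC),
* `ClassX11a W 3` (multiplicative `3`, `r = 0`, no second multiplicative prime ramified in `E[3]`),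
* `ClassX2 W 3` (multiplicative `3`, rational `3`-isogeny).
Class X9 (small irreducible image at good ordinary `p ≥ 5`) is EMPTY at `3` by its definition.
OUTSIDE the statement at `3` by its wording, as on the whole map: additive reduction at `3`
(X3@3 / X4@3 — 72 % of the sweep residue), multiplicative `3` in rank `1` (X11b@3, X2c@3), and the
CM bad-prime corner (K12i@3 / K12r@3, `Partition/CornersCM.lean`).

Quotable covered cells at `3` (each from THREE or fewer named facts, not fourteen):
`bsdp_three_of_goodOrd_of_surj` (good ordinary `3`, `ρ̄_{E,3}` onto, any `r ≤ 1`: row C16 = Yan–Zhu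
2026 Thm 4.15 with the S–U/JSW floor, PUB\*), `bsdp_three_of_good_of_red_of_not_anom` (good `3`,
rational `3`-isogeny, non-anomalous: row C6 = CGS 2025 Thm D), `bsdp_three_of_goodSS_rankOne`
(supersingular `3`, `a_3 = 0`, `r = 1`, semistable: row C3 = JSW 2017 Thm 1.2.1, PUB\* `JSW-ss`),
`bsdp_three_of_mult_rankZero_of_irr_of_ram` (multiplicative `3`, `r = 0`, (irr) ∧ (ram): row C1 =
Skinner 2016 Thm C).

References: RESIDUAL-MAP.md §S (§S.2 table, §S.5), §A/§B/§C corner predicates;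
`Partition/Corners.lean` (rmap-1 gen 2); `Partition/CornersCM.lean` (the CM corner at `3`).
-/

namespace Summit.BirchSwinnertonDyer.Rank1Residual

open WeierstrassCurve Literature.NumberTheory.EllipticCurves
  Literature.NumberTheory.EllipticCurves.Rank1Residual Literature.NumberTheory.EllipticCurves.ModularForms
open scoped NumberField

section Curve

variable {W : WeierstrassCurve ℚ} [W.IsElliptic] [W.IsGloballyMinimal]

/-! ### Elementary facts at `3` -/

omit [W.IsElliptic] in
/-- **Class X9 is empty at `p = 3`**: its definition asks `5 ≤ p` (the small irreducible images
`5Ns/5S4/7Ns` live at `p ∈ {5, 7}`; at `3` the small irreducible images `3Ns/3Nn` are class X10b).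
No published fact is used. [folklore] -/
theorem not_classX9_three : ¬ ClassX9 W 3 := fun h ↦ by
  have h5 : 5 ≤ 3 := h.2.2.1
  omega

omit [W.IsElliptic] in
/-- Good ordinary at `3` excludes good supersingular at `3` (`3 ∤ a_3` vs `3 ∣ a_3`). [folklore] -/
theorem not_goodSS_three_of_goodOrd (hgo : GoodOrd W 3) : ¬ GoodSS W 3 := fun hss ↦ hgo.2 hss.2

/-- At the odd good supersingular prime `3`, `E[3]` is irreducible (Serre 1972 §1.11, tree theorem
`hasIrreducibleModPGaloisRep_of_dvd_frobeniusTrace`); hence a rational `3`-isogeny excludes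
supersingular reduction at a good `3` (RESIDUAL-MAP §0.5 S1 at `p = 3`). [folklore] -/
theorem irr_three_of_goodSS (hss : GoodSS W 3) : Irr W 3 :=
  hasIrreducibleModPGaloisRep_of_dvd_frobeniusTrace W 3 (by decide)
    (W.not_dvd_minimalDiscriminantInt_of_hasGoodReductionAtPrime' 3 hss.1) hss.2

/-! ### The corner statement at `3` -/

/-- **STRONG PARTIAL THEOREM AT `p = 3`, every `E/ℚ` (RESIDUAL-MAP §S.5 as one kernel statement).**
For `W/ℚ` globally minimal elliptic (CM or not) of analytic rank `r ≤ 1`, with `3` good, or `3`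
multiplicative and `r = 0`: granted the fourteen named published facts of the covered rows
(PUB\* flags travel with `hBCS`, `hJSW`, `hYZ`), `BSD(E,3)` holds unless `(W, 3)` lies in one of the
SEVEN named corners at `3` — X10b, X1@3, X6@3 ∧ `r = 0`, X7@3, X8, X11a@3, X2@3. Specialisation of
`bsdp_of_not_corner'` at `p = 3`; the eighth corner X9 of the general statement is empty at `3`
(`not_classX9_three`). [folklore] -/
theorem bsdp_three_of_not_corner (hSk : Skinner2016.thmC_padicValRat_bsd_rank_zero)
    (hBCS : BurungaleCastellaSkinner2025.cor131_padicValRat_bsd_rank_le_one)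
    (hJSW : JetchevSkinnerWan2017.thm121_padicValRat_bsd_rank_one)
    (hCGS : CastellaGrossiSkinner2025.thmD_padicValRat_bsd_rank_le_one)
    (hGV : GreenbergVatsal2000.thm13_charIdeal_eq_of_gvPar) (hGr : greenberg_charValue_rankZero)
    (hmod : hasEntireLFunction_rat) (hmodP : nonempty_modularParametrizationData)
    (hGZK : rank_eq_analyticRank_of_analyticRank_le_one)
    (hCM : bsdTriple_of_hasCM_of_L_one_ne_zero) (hKob : Kobayashi2013.cor14_bsdp_of_cm_rank_one)
    (hYZ : YanZhu2026.thm415_padicValRat_bsd_rank_le_one)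
    (hW20 : Wuthrich2014.lemma20_surjective_threeAdic_of_semistable)
    (hLLT : LiLiuTian2024.thm11_bsdp_of_cm_rank_one)
    (hr : W.analyticRank ≤ 1) (hdom : Good W 3 ∨ (Mult W 3 ∧ W.analyticRank = 0))
    (hX10b : ¬ (ClassX10 W 3 ∧ ¬ Surj W 3)) (hX1 : ¬ ClassX1 W 3)
    (hX6 : ¬ (ClassX6 W 3 ∧ W.analyticRank = 0)) (hX7 : ¬ ClassX7 W 3) (hX8 : ¬ ClassX8 W 3)
    (hX11a : ¬ ClassX11a W 3) (hX2 : ¬ ClassX2 W 3) : BSDp W 3 :=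
  bsdp_of_not_corner' hSk hBCS hJSW hCGS hGV hGr hmod hmodP hGZK hCM hKob hYZ hW20 hLLT hr (by decide)
    hdom hX1 not_classX9_three hX10b hX6 hX7 hX8 hX11a hX2

/-- **Good primes at `3`, corner form**: at a GOOD `3` the multiplicative corners X11a / X2 are
vacuous, so five corners remain (X10b, X1@3, X6@3 ∧ `r = 0`, X7@3, X8). [folklore] -/
theorem bsdp_three_good_of_not_corner (hSk : Skinner2016.thmC_padicValRat_bsd_rank_zero)
    (hBCS : BurungaleCastellaSkinner2025.cor131_padicValRat_bsd_rank_le_one)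
    (hJSW : JetchevSkinnerWan2017.thm121_padicValRat_bsd_rank_one)
    (hCGS : CastellaGrossiSkinner2025.thmD_padicValRat_bsd_rank_le_one)
    (hGV : GreenbergVatsal2000.thm13_charIdeal_eq_of_gvPar) (hGr : greenberg_charValue_rankZero)
    (hmod : hasEntireLFunction_rat) (hmodP : nonempty_modularParametrizationData)
    (hGZK : rank_eq_analyticRank_of_analyticRank_le_one)
    (hCM : bsdTriple_of_hasCM_of_L_one_ne_zero) (hKob : Kobayashi2013.cor14_bsdp_of_cm_rank_one)
    (hYZ : YanZhu2026.thm415_padicValRat_bsd_rank_le_one)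
    (hW20 : Wuthrich2014.lemma20_surjective_threeAdic_of_semistable)
    (hLLT : LiLiuTian2024.thm11_bsdp_of_cm_rank_one)
    (hr : W.analyticRank ≤ 1) (hgood : Good W 3)
    (hX10b : ¬ (ClassX10 W 3 ∧ ¬ Surj W 3)) (hX1 : ¬ ClassX1 W 3)
    (hX6 : ¬ (ClassX6 W 3 ∧ W.analyticRank = 0)) (hX7 : ¬ ClassX7 W 3) (hX8 : ¬ ClassX8 W 3) :
    BSDp W 3 :=
  bsdp_three_of_not_corner hSk hBCS hJSW hCGS hGV hGr hmod hmodP hGZK hCM hKob hYZ hW20 hLLT hr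
    (Or.inl hgood) hX10b hX1 hX6 hX7 hX8
    (fun h11a ↦ not_mult_of_good W 3 hgood h11a.2.2.1) (fun h2 ↦ not_mult_of_good W 3 hgood h2.2.2)

/-! ### The COVERED cells at `3`, quotable forms -/

/-- **Good ORDINARY `3` with `ρ̄_{E,3}` SURJECTIVE, any analytic rank `≤ 1`: `BSD(E,3)`** — every
corner at `3` is excluded: X1 and X2 need `E[3]` reducible, X10b needs `ρ̄` non-surjective,
X6/X7/X8 need supersingular `3`, X11a/X2 need multiplicative `3`. This is RESIDUAL-MAP §S.2 row
'§A good ordinary, ρ̄ surjective' (T6 Yan–Zhu 2026 Thm 4.15 at `3` [PUB\*, `YZ26@3-BF-ERL-Ohta`]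
with the flag-free sub-cells T2 (ram) / T4 (semistable rank one) inside row C16's binding).
[folklore] -/
theorem bsdp_three_of_goodOrd_of_surj (hSk : Skinner2016.thmC_padicValRat_bsd_rank_zero)
    (hBCS : BurungaleCastellaSkinner2025.cor131_padicValRat_bsd_rank_le_one)
    (hJSW : JetchevSkinnerWan2017.thm121_padicValRat_bsd_rank_one)
    (hCGS : CastellaGrossiSkinner2025.thmD_padicValRat_bsd_rank_le_one)
    (hGV : GreenbergVatsal2000.thm13_charIdeal_eq_of_gvPar) (hGr : greenberg_charValue_rankZero)
    (hmod : hasEntireLFunction_rat) (hmodP : nonempty_modularParametrizationData)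
    (hGZK : rank_eq_analyticRank_of_analyticRank_le_one)
    (hCM : bsdTriple_of_hasCM_of_L_one_ne_zero) (hKob : Kobayashi2013.cor14_bsdp_of_cm_rank_one)
    (hYZ : YanZhu2026.thm415_padicValRat_bsd_rank_le_one)
    (hW20 : Wuthrich2014.lemma20_surjective_threeAdic_of_semistable)
    (hLLT : LiLiuTian2024.thm11_bsdp_of_cm_rank_one)
    (hr : W.analyticRank ≤ 1) (hgo : GoodOrd W 3) (hsurj : Surj W 3) : BSDp W 3 :=
  have hirr : Irr W 3 := irr_of_surj W 3 hsurj
  have hnss : ¬ GoodSS W 3 := not_goodSS_three_of_goodOrd hgo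
  bsdp_three_good_of_not_corner hSk hBCS hJSW hCGS hGV hGr hmod hmodP hGZK hCM hKob hYZ hW20 hLLT hr
    hgo.1 (fun ⟨_, hns⟩ ↦ hns hsurj) (fun h1 ↦ h1.2.1 hirr) (fun ⟨h6, _⟩ ↦ hnss h6.1)
    (fun h7 ↦ hnss h7.1) (fun h8 ↦ hnss h8.2.1)

/-- **Good `3` with a rational `3`-isogeny (reducible `E[3]`) and NON-ANOMALOUS kernel character,
any analytic rank `≤ 1`: `BSD(E,3)`** — X1 needs `anom`, X10b needs `E[3]` irreducible, the
supersingular corners X6/X7/X8 are empty for reducible `E[3]` at a good `3` (`irr_three_of_goodSS`),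
X11a/X2 need multiplicative `3`. This is RESIDUAL-MAP §S.2 row '§A good, reducible, ¬anom' (T7
Castella–Grossi–Skinner 2025 Thm D [PUB, informational flag `CGS25-BST-Thm311`]; the ¬gvpar rank-one
quadrant flag-free by T8 CGLS 2022 Thm F inside row C6's binding). [folklore] -/
theorem bsdp_three_of_good_of_red_of_not_anom (hSk : Skinner2016.thmC_padicValRat_bsd_rank_zero)
    (hBCS : BurungaleCastellaSkinner2025.cor131_padicValRat_bsd_rank_le_one)
    (hJSW : JetchevSkinnerWan2017.thm121_padicValRat_bsd_rank_one)
    (hCGS : CastellaGrossiSkinner2025.thmD_padicValRat_bsd_rank_le_one)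
    (hGV : GreenbergVatsal2000.thm13_charIdeal_eq_of_gvPar) (hGr : greenberg_charValue_rankZero)
    (hmod : hasEntireLFunction_rat) (hmodP : nonempty_modularParametrizationData)
    (hGZK : rank_eq_analyticRank_of_analyticRank_le_one)
    (hCM : bsdTriple_of_hasCM_of_L_one_ne_zero) (hKob : Kobayashi2013.cor14_bsdp_of_cm_rank_one)
    (hYZ : YanZhu2026.thm415_padicValRat_bsd_rank_le_one)
    (hW20 : Wuthrich2014.lemma20_surjective_threeAdic_of_semistable)
    (hLLT : LiLiuTian2024.thm11_bsdp_of_cm_rank_one)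
    (hr : W.analyticRank ≤ 1) (hgood : Good W 3) (hred : Red W 3) (hna : ¬ Anom W 3) : BSDp W 3 :=
  have hnss : ¬ GoodSS W 3 := fun hss ↦ hred (irr_three_of_goodSS hss)
  bsdp_three_good_of_not_corner hSk hBCS hJSW hCGS hGV hGr hmod hmodP hGZK hCM hKob hYZ hW20 hLLT hr
    hgood (fun ⟨h10, _⟩ ↦ hred h10.2.2.1) (fun h1 ↦ hna h1.2.2.2.1) (fun ⟨h6, _⟩ ↦ hnss h6.1)
    (fun h7 ↦ hnss h7.1) (fun h8 ↦ hnss h8.2.1)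

/-- **Good `3` with a rational `3`-isogeny, outside class X1 in its own terms**: `BSD(E,3)` whenever
the kernel character is non-anomalous OR the pair sits in the rank-`0` Greenberg–Vatsal-parity
quadrant (T9, the `GV-chain` / CGLS 2022 Thm 5.1.4 cell) — i.e. `Anom W 3 → (r = 0 ∧ GVPar W 3)`.
[folklore] -/
theorem bsdp_three_of_good_of_red (hSk : Skinner2016.thmC_padicValRat_bsd_rank_zero)
    (hBCS : BurungaleCastellaSkinner2025.cor131_padicValRat_bsd_rank_le_one)
    (hJSW : JetchevSkinnerWan2017.thm121_padicValRat_bsd_rank_one)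
    (hCGS : CastellaGrossiSkinner2025.thmD_padicValRat_bsd_rank_le_one)
    (hGV : GreenbergVatsal2000.thm13_charIdeal_eq_of_gvPar) (hGr : greenberg_charValue_rankZero)
    (hmod : hasEntireLFunction_rat) (hmodP : nonempty_modularParametrizationData)
    (hGZK : rank_eq_analyticRank_of_analyticRank_le_one)
    (hCM : bsdTriple_of_hasCM_of_L_one_ne_zero) (hKob : Kobayashi2013.cor14_bsdp_of_cm_rank_one)
    (hYZ : YanZhu2026.thm415_padicValRat_bsd_rank_le_one)
    (hW20 : Wuthrich2014.lemma20_surjective_threeAdic_of_semistable)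
    (hLLT : LiLiuTian2024.thm11_bsdp_of_cm_rank_one)
    (hr : W.analyticRank ≤ 1) (hgood : Good W 3) (hred : Red W 3)
    (hgv : Anom W 3 → (W.analyticRank = 0 ∧ GVPar W 3)) : BSDp W 3 :=
  have hnss : ¬ GoodSS W 3 := fun hss ↦ hred (irr_three_of_goodSS hss)
  bsdp_three_good_of_not_corner hSk hBCS hJSW hCGS hGV hGr hmod hmodP hGZK hCM hKob hYZ hW20 hLLT hr
    hgood (fun ⟨h10, _⟩ ↦ hred h10.2.2.1) (fun h1 ↦ h1.2.2.2.2 (hgv h1.2.2.2.1))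
    (fun ⟨h6, _⟩ ↦ hnss h6.1) (fun h7 ↦ hnss h7.1) (fun h8 ↦ hnss h8.2.1)

/-- **Supersingular `3` with `a_3 = 0`, rank one, semistable: `BSD(E,3)`** — the one COVERED
supersingular cell at `3` (row C3 = JSW 2017 Thm 1.2.1 'if `p = 3`, provided `a_p(E) = 0`'; PUB\*
flag `JSW-ss`; three named facts). RESIDUAL-MAP §S.2 row X6@3, `r = 1`. [folklore] -/
theorem bsdp_three_of_goodSS_rankOne (hJSW : JetchevSkinnerWan2017.thm121_padicValRat_bsd_rank_one)
    (hmod : hasEntireLFunction_rat) (hGZK : rank_eq_analyticRank_of_analyticRank_le_one)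
    (hss : GoodSS W 3) (hsst : Semistable W) (hr1 : W.analyticRank = 1)
    (ha3 : W.frobeniusTrace 3 = 0) : BSDp W 3 :=
  bsdp_goodSS_rankOne_semistable hJSW hmod hGZK (by decide) hss hsst hr1 (Or.inr ha3)

/-- **Multiplicative `3`, rank `0`, `E[3]` irreducible and ramified at a second multiplicative
prime: `BSD(E,3)`** — row C1 = Skinner 2016 Thm C (`p = 3` inside its standing hypotheses; three
named facts). RESIDUAL-MAP §S.2 row '§C multiplicative, irreducible, (ram)', `r = 0`. [folklore] -/
theorem bsdp_three_of_mult_rankZero_of_irr_of_ram (hSk : Skinner2016.thmC_padicValRat_bsd_rank_zero)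
    (hmod : hasEntireLFunction_rat) (hGZK : rank_eq_analyticRank_of_analyticRank_le_one)
    (hm : Mult W 3) (hr0 : W.analyticRank = 0) (hirr : Irr W 3) (hram : Ram W 3) : BSDp W 3 :=
  bsdp_mult_rankZero_of_irr_of_ram hSk hmod hGZK (by decide) hm hr0 hirr hram

/-! ### The map at `p = 3` is complete: every pair is COVERED or in a named, decidable cell
(appended, rmap-3 gen 3; RESIDUAL-MAP.md §S.2 / §S.3 — "no cell left blank" at `p = 3`) -/

/-- **THE PARTITION AT `p = 3` (RESIDUAL-MAP §S as one kernel statement).** For EVERY globally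
minimal elliptic `W/ℚ` (CM or not, ANY reduction type at `3`) of analytic rank `r ≤ 1`: granted the
fourteen named published facts of the covered rows, EITHER `BSD(E,3)` holds, OR `(W, 3)` lies in
one of the ELEVEN named cells of §S — the seven good/multiplicative-rank-0 corners of
`bsdp_three_of_not_corner` (X10b, X1@3, X6@3 ∧ `r = 0`, X7@3, X8, X11a@3, X2@3), the two
additive cells X3@3 (`ClassX3 W 3`: rational `3`-isogeny, additive) and X4@3 (`ClassX4 W 3`:
irreducible, additive — 72 % of the sweep residue), the rank-one multiplicative cell X11b@3
(`ClassX11b W 3`), or the CM corner `CornerF W 3` (= K12i@3 ∪ K12r@3: CM, rank one, `3 ∣ N`,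
`3` not split in `K`; `CornersCM.cornerF_iff_of_ne_two`). Each cell is an explicit predicate in
the atoms of `Predicates.lean` (decidable on `(a₁,…,a₆, 3)` given `r`, RESIDUAL-MAP §S / §F
DECIDABILITY). Proof: CM ⇒ `CornersCM.bsdp_cm_of_not_cornerF`; non-CM ⇒
`bsdp_or_residualV3_or_classX11b` and a walk through X1–X12: X5 needs `3 = 2`, X9 needs `5 ≤ 3`,
X12 needs CM, X6 with `r = 1` is row C3 (JSW, PUB\* `JSW-ss`), the surjective part of the tree's
X10 is row C16 (Yan–Zhu, PUB\*), and the tree's X11 is X11a in rank `0` / X11b in rank `1`.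
[folklore] -/
theorem bsdp_three_or_cell (hSk : Skinner2016.thmC_padicValRat_bsd_rank_zero)
    (hBCS : BurungaleCastellaSkinner2025.cor131_padicValRat_bsd_rank_le_one)
    (hJSW : JetchevSkinnerWan2017.thm121_padicValRat_bsd_rank_one)
    (hCGS : CastellaGrossiSkinner2025.thmD_padicValRat_bsd_rank_le_one)
    (hGV : GreenbergVatsal2000.thm13_charIdeal_eq_of_gvPar) (hGr : greenberg_charValue_rankZero)
    (hmod : hasEntireLFunction_rat) (hmodP : nonempty_modularParametrizationData)
    (hGZK : rank_eq_analyticRank_of_analyticRank_le_one)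
    (hCM : bsdTriple_of_hasCM_of_L_one_ne_zero) (hKob : Kobayashi2013.cor14_bsdp_of_cm_rank_one)
    (hYZ : YanZhu2026.thm415_padicValRat_bsd_rank_le_one)
    (hW20 : Wuthrich2014.lemma20_surjective_threeAdic_of_semistable)
    (hLLT : LiLiuTian2024.thm11_bsdp_of_cm_rank_one)
    (hr : W.analyticRank ≤ 1) :
    BSDp W 3 ∨
      ((ClassX10 W 3 ∧ ¬ Surj W 3) ∨ ClassX1 W 3 ∨ (ClassX6 W 3 ∧ W.analyticRank = 0) ∨
        ClassX7 W 3 ∨ ClassX8 W 3 ∨ ClassX11a W 3 ∨ ClassX2 W 3 ∨ ClassX3 W 3 ∨ ClassX4 W 3 ∨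
        ClassX11b W 3 ∨ CornerF W 3) := by
  by_cases hcm : W.HasCM
  · by_cases hF : CornerF W 3
    · exact Or.inr (Or.inr (Or.inr (Or.inr (Or.inr (Or.inr (Or.inr (Or.inr (Or.inr (Or.inr
        (Or.inr hF))))))))))
    · exact Or.inl (bsdp_cm_of_not_cornerF hCM hmod hLLT hKob hcm hr hF)
  · rcases bsdp_or_residualV3_or_classX11b (W := W) (p := 3) hSk hBCS hJSW hCGS hGV hGr hmod hmodP
        hGZK hCM hKob hYZ hW20 hLLT hr with h | hres | hx11b
    · exact Or.inl h
    · rcases hres with h1 | h2 | h3 | h4 | h5 | h6 | h7 | h8 | h9 | h10 | h11 | h12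
      · exact Or.inr (Or.inr (Or.inl h1))
      · exact Or.inr (Or.inr (Or.inr (Or.inr (Or.inr (Or.inr (Or.inr (Or.inl h2)))))))
      · exact Or.inr (Or.inr (Or.inr (Or.inr (Or.inr (Or.inr (Or.inr (Or.inr (Or.inl h3))))))))
      · exact Or.inr (Or.inr (Or.inr (Or.inr (Or.inr (Or.inr (Or.inr (Or.inr (Or.inr
          (Or.inl h4)))))))))
      · -- X5 needs `p = 2`
        exact ((by decide : (3 : ℕ) ≠ 2) h5).elim
      · -- X6: rank 0 is the corner, rank 1 is row C3 (JSW 2017 Thm 1.2.1 at 3 with a_3 = 0, PUB*)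
        have hrk : W.analyticRank = 0 ∨ W.analyticRank = 1 := by omega
        rcases hrk with hr0 | hr1
        · exact Or.inr (Or.inr (Or.inr (Or.inl ⟨h6, hr0⟩)))
        · exact Or.inl (RowC3.bsdp hJSW hmod hGZK
            (rowC3_of_goodSS_rankOne (by decide) h6.1 h6.2.1 hr1 h6.2.2))
      · exact Or.inr (Or.inr (Or.inr (Or.inr (Or.inl h7))))
      · exact Or.inr (Or.inr (Or.inr (Or.inr (Or.inr (Or.inl h8)))))
      · exact absurd h9 not_classX9_three
      · -- X10 (tree): the surjective part is row C16 (Yan–Zhu 2026, PUB* `YZ26@3`), the rest is X10b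
        by_cases hs : Surj W 3
        · obtain ⟨-, hord, hirr, -⟩ := h10
          exact Or.inl (RowC16.bsdp hYZ hW20 hmod hGZK hr ⟨rfl, hord, hirr, Or.inl hs⟩)
        · exact Or.inr (Or.inl ⟨h10, hs⟩)
      · -- X11 (tree): multiplicative irreducible — X11a in rank 0 (the ¬(ram) clause), X11b in rank 1
        obtain ⟨hm, hirr, hcl⟩ := h11
        have hrk : W.analyticRank = 0 ∨ W.analyticRank = 1 := by omega
        rcases hrk with hr0 | hr1
        · rcases hcl with hnr | ⟨hr1, -⟩ | ⟨hr1, -⟩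
          · exact Or.inr (Or.inr (Or.inr (Or.inr (Or.inr (Or.inr (Or.inl ⟨hr0, by decide, hm, hirr,
              hnr⟩))))))
          · omega
          · omega
        · exact Or.inr (Or.inr (Or.inr (Or.inr (Or.inr (Or.inr (Or.inr (Or.inr (Or.inr (Or.inr
            (Or.inl ⟨hr1, by decide, hm, hirr⟩))))))))))
      · exact absurd h12.1 hcm
    · exact Or.inr (Or.inr (Or.inr (Or.inr (Or.inr (Or.inr (Or.inr (Or.inr (Or.inr (Or.inr
        (Or.inl hx11b))))))))))

end Curve

end Summit.BirchSwinnertonDyer.Rank1Residual
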